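import Literature.AnabelianGeometry.SemiGraphs.ArithLevelTower
import Literature.AnabelianGeometry.SemiGraphs.TemperedPiTreesTrans
import Literature.AnabelianGeometry.SemiGraphs.TemperedPiPresentationTowerInputs
import HarnessLib

/-!
# The arithmetic tower: transitions `i ≤ j` ([SemiAnbd] Thm 3.7 (iii) p. 41, Thm 5.4 p. 66)

Mochizuki, *Semi-graphs of anabelioids*, Publ. RIMS **42** (2006), §3 proof of Thm. 3.7 (iii) p. 41
("natural maps `V_i → V_j`, `E_i → E_j`") and §5 proof of Thm. 5.4 p. 66 ("natural compatible actions of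
`H` on `𝔾`, `𝔾_i`") [cite: MochizukiSemiAnbd2006, Thm 5.4, p. 66].

Cell row T54-B (plan/GAP-LEDGER.md G-w4d053-1), tower third, file T3e-4: the `∀ i ≤ j` forms of the
transition statements of `TemperedPiTreeCosetIso.lean`, `TemperedPiLevelCosetIso.lean`, `ArithTreeTower.lean`
and `ArithLevelTower.lean`, by induction along abc-iut-L3-t6's `treeTrans` / `levelTrans` (`Nat.leRec`
composites of the steps): the kernels `ker π_n` are antitone (`ker ρ_n`: abc-iut-w4-d082's `ker_projAut_anti`); the identifications
`treeCosetIso` / `levelCosetIso` carry `cosetGraphTrans (ker ρ_j ≤ ker ρ_i)` / `cosetGraphTrans (ker π_j ≤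
ker π_i)` to `treeTrans` / `levelTrans`; and the arithmetic actions commute with `treeTrans` / `levelTrans`
(the literal `trans_act` / `levelTrans_act` fields of the cell's `ArithLevelData`).  Typed ≠ proved for
[SemiAnbd] Thm 5.4 itself; nothing here bears on [IUTchIII] Cor. 3.12.
-/

namespace Literature.AnabelianGeometry.SemiGraphs

namespace ProfiniteSemiGraph

namespace GaloisLevelData

open CategoryTheory

universe u v

variable {𝒢 : ProfiniteSemiGraph.{u}} (D : GaloisLevelData 𝒢) (h𝒢 : 𝒢.IsCountable)
  (hconn : ∀ (n : ℕ) (p q : (D.S n).Point), (D.S n).SameComponent p q)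
  (T : ∀ w : 𝒢.graph.Vertex, D.PointSeq h𝒢 w) (R : SemiGraph.RefBranches 𝒢.graph)
  {E : Type v} [Group E] {Φ : E →* MulAut (D.temperedPi h𝒢)} {σ : E →* Aut 𝒢.graph}
  (hP : (D.piPresentation h𝒢 T R).IsArithCompatible Φ σ)
  (hK : ∀ (n : ℕ) (e : E) (x : D.temperedPi h𝒢), x ∈ (D.projAut h𝒢 n).ker → Φ e x ∈ (D.projAut h𝒢 n).ker)
  (hN : ∀ (n : ℕ) (e : E) (x : D.temperedPi h𝒢),
    x ∈ (D.piLevelAut h𝒢 hconn n).ker → Φ e x ∈ (D.piLevelAut h𝒢 hconn n).ker)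

/-! ### The kernels are antitone -/

/-- `ker π_j ≤ ker π_i` for `i ≤ j`. [cite: MochizukiSemiAnbd2006, Prop 3.6 p.38] -/
theorem ker_piLevelAut_le_of_le {i j : ℕ} (h : i ≤ j) :
    (D.piLevelAut h𝒢 hconn j).ker ≤ (D.piLevelAut h𝒢 hconn i).ker := by
  induction j, h using Nat.le_induction with
  | base => exact le_rfl
  | succ k _ ih => exact (D.ker_piLevelAut_succ_le h𝒢 hconn k).trans ih

/-! ### The identifications and the transitions `i ≤ j` -/

/-- **`treeCosetIso` carries `cosetGraphTrans (ker ρ_j ≤ ker ρ_i)` to abc-iut-L3-t6's `treeTrans`.**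
[cite: MochizukiSemiAnbd2006, Thm 3.7(iii) p.41] -/
theorem treeCosetIso_treeTrans {i j : ℕ} (h : i ≤ j) :
    (D.treeCosetIso h𝒢 T R j).hom ≫ D.treeTrans h =
      (D.piPresentation h𝒢 T R).cosetGraphTrans (D.ker_projAut_anti h𝒢 h) ≫
        (D.treeCosetIso h𝒢 T R i).hom := by
  induction j, h using Nat.le_induction with
  | base =>
    rw [treeTrans_self, Category.comp_id, SemiGraph.SubgroupPresentation.cosetGraphTrans_refl,
      Category.id_comp]
  | succ k h ih =>
    rw [D.treeTrans_succ h, ← Category.assoc, D.treeCosetIso_trans h𝒢 T R k, Category.assoc, ih,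
      ← Category.assoc, SemiGraph.SubgroupPresentation.cosetGraphTrans_comp]

/-- **`levelCosetIso` carries `cosetGraphTrans (ker π_j ≤ ker π_i)` to abc-iut-L3-t6's `levelTrans`.**
[cite: MochizukiSemiAnbd2006, Thm 3.7(iii) p.41] -/
theorem levelCosetIso_levelTrans {i j : ℕ} (h : i ≤ j) :
    (D.levelCosetIso h𝒢 hconn T R j).hom ≫ D.levelTrans h =
      (D.piPresentation h𝒢 T R).cosetGraphTrans (D.ker_piLevelAut_le_of_le h𝒢 hconn h) ≫
        (D.levelCosetIso h𝒢 hconn T R i).hom := by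
  induction j, h using Nat.le_induction with
  | base =>
    rw [levelTrans_self, Category.comp_id, SemiGraph.SubgroupPresentation.cosetGraphTrans_refl,
      Category.id_comp]
  | succ k h ih =>
    rw [D.levelTrans_succ h, ← Category.assoc, D.levelCosetIso_trans h𝒢 hconn T R k, Category.assoc, ih,
      ← Category.assoc, SemiGraph.SubgroupPresentation.cosetGraphTrans_comp]

/-! ### The arithmetic actions and the transitions `i ≤ j` -/

/-- **`trans_act`: the arithmetic tree actions commute with the transitions `treeTrans (i ≤ j)`.**
[cite: MochizukiSemiAnbd2006, Thm 5.4, p. 66] -/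
theorem arithTreeAct_treeTrans {i j : ℕ} (h : i ≤ j) (e : E) :
    (D.arithTreeAct h𝒢 T R hP hK j e).hom ≫ D.treeTrans h =
      D.treeTrans h ≫ (D.arithTreeAct h𝒢 T R hP hK i e).hom := by
  induction j, h using Nat.le_induction with
  | base => rw [treeTrans_self, Category.id_comp, Category.comp_id]
  | succ k h ih =>
    rw [D.treeTrans_succ h, ← Category.assoc, D.arithTreeAct_treeStep h𝒢 T R hP hK k e, Category.assoc, ih,
      Category.assoc]

/-- **`levelTrans_act`: the arithmetic level actions commute with the transitions `levelTrans (i ≤ j)`.**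
[cite: MochizukiSemiAnbd2006, Thm 5.4, p. 66] -/
theorem arithLevelAct_levelTrans {i j : ℕ} (h : i ≤ j) (e : E) :
    (D.arithLevelAct h𝒢 hconn T R hP hN j e).hom ≫ D.levelTrans h =
      D.levelTrans h ≫ (D.arithLevelAct h𝒢 hconn T R hP hN i e).hom := by
  induction j, h using Nat.le_induction with
  | base => rw [levelTrans_self, Category.id_comp, Category.comp_id]
  | succ k h ih =>
    rw [D.levelTrans_succ h, ← Category.assoc, D.arithLevelAct_levelStep h𝒢 hconn T R hP hN k e,
      Category.assoc, ih, Category.assoc]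

/-- **`act_quot` along `i ≤ j`: the arithmetic tree action at level `j` covers the arithmetic level
action at level `i` through `treeTrans ≫ treeQuot`.** [cite: MochizukiSemiAnbd2006, Thm 5.4, p. 66] -/
theorem arithTreeAct_treeTrans_treeQuot {i j : ℕ} (h : i ≤ j) (e : E) :
    (D.arithTreeAct h𝒢 T R hP hK j e).hom ≫ (D.treeTrans h ≫ D.treeQuot i) =
      (D.treeTrans h ≫ D.treeQuot i) ≫ (D.arithLevelAct h𝒢 hconn T R hP hN i e).hom := by
  rw [← Category.assoc, D.arithTreeAct_treeTrans h𝒢 T R hP hK h e, Category.assoc,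
    D.arithTreeAct_treeQuot h𝒢 hconn T R hP hK hN i e, Category.assoc]

end GaloisLevelData

end ProfiniteSemiGraph

end Literature.AnabelianGeometry.SemiGraphs
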